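import Summits.BirchSwinnertonDyer.Rank1Residual.Additive.QuadraticBranchOddStrictSelmer
import Literature.NumberTheory.EllipticCurves.CyclotomicInterpolantUniquenessProofs
import Mathlib.NumberTheory.LegendreSymbol.QuadraticChar.Basic
import Mathlib.RingTheory.Polynomial.Cyclotomic.Roots
import Mathlib.FieldTheory.IsAlgClosed.Basic
import HarnessLib

/-!
# Kobayashi's minus function on the quadratic branch is DETERMINED UP TO A UNIT by its
# interpolation property: two `L` with `IsQuadraticBranchMinusLFunction f p ϖ L` differ by a unit of
# `ℤ_p` (proofs only; cell `b2b-bsdres`, CLASS-CLOSURE lane, seat x1b GEN 29 — X12 / O10 prover owner)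

HONEST FRAMING (cell `b2b-bsdres`, run/shared/lean/b2b/bsd-rank1-residual/, verbatim in every
file): the goal of the cell is to DELETE the COMBINATION-SHAPED residual classes of the
Birch–Swinnerton-Dyer formula for ALL analytic-rank `≤ 1` elliptic curves over `ℚ` — "full BSD
formula for every rank `≤ 1` curve in class `C`" assembled STRICTLY from published theorems — so
that the rank-`≤ 1` remainder becomes exactly the CONSTRUCTION-SHAPED classes, which are TYPED
(missing-input `Prop`s), NOT attempted. This is not "finishing BSD". This file: THEOREMS ONLY (no
definition, no named fact, no axiom; net debt `0`); nothing is booked; no label moves; nothing about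
any curve is asserted.

## What and why

The tree's predicate `IsQuadraticBranchMinusLFunction f p ϖ L` (cc-typer-6,
`QuadraticBranchOddStrictSelmer.lean`) says that `L ∈ Λ = ℤ_p⟦X⟧` has `L(0) = 0` ((3.7)) and, for
some unit `u ∈ ℤ_p^×`, satisfies Kobayashi's interpolation property (3.5) on the quadratic branch
`η = ω^{(p-1)/2}` at every odd level `n` and every Dirichlet character `ψ` mod `p^{n+1}` of order
`2pⁿ` (`= ηχ`). Its docstring records "such an `L` is unique up to `ℤ_p^×` (infinitely many
interpolation points in the open disc)" — but that was not a kernel theorem, so every typed item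
quantifying over all such `L` (`QuadraticBranchMinusLeadingValuationAt`, the EVIDENCE law P2♭;
`OddBranchUnitCertificateAt`, the unit certificate `IsUnit (coeff₁ L)`) a priori depends on the
choice of `L`. This file PROVES the uniqueness up to a unit
(`IsQuadraticBranchMinusLFunction.exists_units_smul_eq`, for `p ≠ 2`), hence that `coeff₁ L` is
determined up to a unit (`…coeff_one_eq_units_mul`), that `IsUnit (coeff₁ L)` and `‖coeff₁ L‖` are
independent of the choice (`…isUnit_coeff_one_iff`, `…norm_coeff_one_eq`): the typed items speak
about Kobayashi's `L_p⁻(V, η, X)` itself, exactly as `IsSignedPAdicLFunction.unique` (harvest-2,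
`Kobayashi2003/SignedPAdicLFunctionUniqueProofs.lean`) does on the trivial branch.

Argument (Pollack 2003 §6.3 / MTT §I.12–I.14, as in the trivial-branch file): if `(L₁, u₁)` and
`(L₂, u₂)` both satisfy the property then at every interpolation point `z = ψ(γ) - 1` the values
satisfy `u₂ · L₁(z) = u₁ · L₂(z)` (the right-hand sides of (3.5) are `u_i` times a common
quantity), so `D = u₂L₁ - u₁L₂ ∈ Λ` vanishes at `z`; for every odd `n ≥ 1` there IS a character
`ψ` mod `p^{n+1}` of order exactly `2pⁿ` with `ψ(γ)` a prescribed primitive `pⁿ`-th root of unity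
(`exists_dirichletCharacter_orderOf_two_mul_prime_pow`: the quadratic character mod `p` lifted to
level `p^{n+1}`, of order `2` and trivial at `γ = 1 + p`, times the character of `Γ` with
`χ(γ) = ζ` supplied by the tree's `exists_character_apply_cyclotomicGenerator_eq`, whose order is
pinned to `pⁿ` by `χ(γ)` having order `pⁿ` and `χ^{φ(p^{n+1})} = 1`), so `D` has infinitely many
zeros `ζ_n - 1` in the open unit disc, hence `D = 0` (`MemIwasawaRat.finite_setOf_hasSum_zero`,
Weierstrass preparation), i.e. `L₂ = (u₂/u₁) L₁`.

References: [Kobayashi2003] Thm. 3.2, (3.5), (3.7) (p. 7); [Pollack2003] Prop. 6.9 (proof), §3;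
[MazurTateTeitelbaum1986Invent] §I.12–I.14; Washington, GTM 83, Thm. 7.3.
-/

noncomputable section

open scoped Classical MatrixGroups ModularForm

open CongruenceSubgroup Polynomial Literature.NumberTheory.EllipticCurves
  Literature.NumberTheory.EllipticCurves.ModularForms

namespace Summit.BirchSwinnertonDyer.Rank1Residual.Additive

variable {p : ℕ} [hp : Fact p.Prime]

/-! ## §1 Characters of order `2pⁿ` modulo `p^{n+1}` with prescribed value at `γ` -/

/-- Primitive `p^n`-th roots of unity exist in `ℂ_p`. [folklore] -/
theorem exists_isPrimitiveRoot_padicComplex' (n : ℕ) :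
    ∃ ζ : ℂ_[p], IsPrimitiveRoot ζ (p ^ n) := by
  have hpos : 0 < p ^ n := pow_pos hp.out.pos n
  obtain ⟨ζ, hζ⟩ := IsAlgClosed.exists_root (cyclotomic (p ^ n) ℂ_[p])
    (degree_cyclotomic_pos (p ^ n) ℂ_[p] hpos).ne'
  exact ⟨ζ, (isRoot_cyclotomic_iff_charZero hpos).mp hζ⟩

/-- A multiplicative character of `(ℤ/m)` kills the order of the unit group:
`χ ^ #(ℤ/m)^× = 1`. [folklore] -/
theorem mulChar_pow_card_units_eq_one {R : Type*} [CommMonoidWithZero R] {m : ℕ} [NeZero m]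
    (χ : DirichletCharacter R m) : χ ^ Fintype.card (ZMod m)ˣ = 1 := by
  ext a
  rw [MulChar.pow_apply_coe, ← map_pow, ← Units.val_pow_eq_pow_val, pow_card_eq_one,
    Units.val_one, map_one, MulChar.one_apply_coe]

/-- **The quadratic character modulo an odd prime `p`, with values in `ℂ_p`, has order `2`.**
[folklore] -/
theorem orderOf_quadraticChar_ringHomComp (hp2 : p ≠ 2) :
    orderOf ((quadraticChar (ZMod p)).ringHomComp (Int.castRingHom ℂ_[p])) = 2 := by
  set chiQ : MulChar (ZMod p) ℂ_[p] := (quadraticChar (ZMod p)).ringHomComp (Int.castRingHom ℂ_[p])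
  have hq : chiQ.IsQuadratic := (quadraticChar_isQuadratic (ZMod p)).comp _
  refine orderOf_eq_prime hq.sq_eq_one fun h1 ↦ ?_
  have hchar : ringChar (ZMod p) ≠ 2 := by rwa [ZMod.ringChar_zmod_n]
  obtain ⟨a, ha⟩ := quadraticChar_exists_neg_one hchar
  have h := congrArg (fun χ : MulChar (ZMod p) ℂ_[p] ↦ χ a) h1
  simp only [chiQ, MulChar.ringHomComp_apply, ha, map_neg, map_one] at h
  have ha0 : a ≠ 0 := by
    rintro rfl
    rw [quadraticChar_zero] at ha
    exact absurd ha (by norm_num)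
  rw [MulChar.one_apply (Ne.isUnit ha0)] at h
  exact absurd h (by norm_num)

/-- **For `p` odd, `n ≥ 1` and `ζ ∈ ℂ_p` a primitive `pⁿ`-th root of unity, there is a Dirichlet
character `ψ` modulo `p^{n+1}` of order exactly `2pⁿ` with `ψ(γ) = ζ`** (`γ = 1 + p` the tree's
`cyclotomicGenerator`): `ψ = η·χ` with `η` the quadratic character mod `p` (order `2`, `η(γ) = 1`)
and `χ` the character of `Γ` with `χ(γ) = ζ` of the tree's
`exists_character_apply_cyclotomicGenerator_eq` (its `p`-power order is `pⁿ`: at least the order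
`pⁿ` of `χ(γ)`, at most the `p`-part of `#(ℤ/p^{n+1})^× = pⁿ(p-1)`). These are exactly the `ψ` of
Kobayashi's (3.5) at level `n`. [cite: Kobayashi2003, §3 (3.5) (p. 7)]
[cite: MazurTateTeitelbaum1986Invent, §I.13] -/
theorem exists_dirichletCharacter_orderOf_two_mul_prime_pow (hp2 : p ≠ 2) {n : ℕ} (hn : 0 < n)
    {ζ : ℂ_[p]} (hζ : IsPrimitiveRoot ζ (p ^ n)) :
    ∃ ψ : DirichletCharacter ℂ_[p] (p ^ (n + 1)),
      orderOf ψ = 2 * p ^ n ∧ ψ (cyclotomicGenerator p : ZMod (p ^ (n + 1))) = ζ := by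
  have hP : p.Prime := hp.out
  have he : cyclotomicExponent p = 1 := if_neg hp2
  obtain ⟨j, rfl⟩ : ∃ j, n = j + 1 := ⟨n - 1, by omega⟩
  haveI : NeZero (p ^ (j + 1 + 1)) := ⟨pow_ne_zero _ hP.ne_zero⟩
  -- the character of `Γ` with `χ(γ) = ζ`, transported to level `p^{j+2}`
  obtain ⟨χ, -, -, ⟨i, hi⟩, hχγ⟩ := exists_character_apply_cyclotomicGenerator_eq (p := p) j hζ
  have hL : p ^ (j + 1 + cyclotomicExponent p) ∣ p ^ (j + 1 + 1) := by rw [he]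
  have hLeq : p ^ (j + 1 + cyclotomicExponent p) = p ^ (j + 1 + 1) := by rw [he]
  set χ' : DirichletCharacter ℂ_[p] (p ^ (j + 1 + 1)) := DirichletCharacter.changeLevel hL χ
    with hχ'_def
  have hordχ' : orderOf χ' = p ^ i := by
    rw [hχ'_def, orderOf_injective (DirichletCharacter.changeLevel hL)
      (DirichletCharacter.changeLevel_injective hL) χ, hi]
  -- the value at `γ` is unchanged
  have hcopZ : IsCoprime ((cyclotomicGenerator p : ℕ) : ℤ) ((p ^ (j + 1 + 1) : ℕ) : ℤ) := by
    rw [Nat.isCoprime_iff_coprime]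
    refine Nat.Coprime.pow_right _ ?_
    rw [cyclotomicGenerator, he, pow_one, Nat.coprime_add_self_left]
    exact Nat.coprime_one_left p
  have hχ'γ : χ' (cyclotomicGenerator p : ZMod (p ^ (j + 1 + 1))) = ζ := by
    have h1 := DirichletCharacter.changeLevel_eq_cast_of_dvd' χ hL
      (a := ((cyclotomicGenerator p : ℕ) : ℤ)) (by exact_mod_cast hcopZ)
    rw [Int.cast_natCast, Int.cast_natCast] at h1
    rw [hχ'_def, h1]
    -- `χ` at its own level: the cast of `γ` is the same numeral
    convert hχγ using 2
  -- pin the order: `orderOf χ' = p^(j+1)`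
  have hζord : orderOf ζ = p ^ (j + 1) := hζ.eq_orderOf.symm
  have hge : j + 1 ≤ i := by
    have h1 : ζ ^ p ^ i = 1 := by
      rw [← hχ'γ, ← MulChar.pow_apply' χ' (pow_ne_zero _ hP.ne_zero), ← hordχ', pow_orderOf_eq_one,
        MulChar.one_apply (isUnit_cyclotomicGenerator_cast p _)]
    have h2 : p ^ (j + 1) ∣ p ^ i := by rw [← hζord]; exact orderOf_dvd_of_pow_eq_one h1
    exact (Nat.pow_dvd_pow_iff_le_right hP.one_lt).mp h2
  have hle : i ≤ j + 1 := by
    have h1 : orderOf χ' ∣ Fintype.card (ZMod (p ^ (j + 1 + 1)))ˣ :=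
      orderOf_dvd_of_pow_eq_one (mulChar_pow_card_units_eq_one χ')
    rw [hordχ', ZMod.card_units_eq_totient, Nat.totient_prime_pow hP (by omega),
      show j + 1 + 1 - 1 = j + 1 from rfl] at h1
    have hcop : Nat.Coprime (p ^ i) (p - 1) :=
      Nat.Coprime.pow_left _ ((Nat.coprime_self_sub_right hP.one_le).mpr (Nat.coprime_one_right p))
    have h2 : p ^ i ∣ p ^ (j + 1) := hcop.dvd_of_dvd_mul_right h1
    exact (Nat.pow_dvd_pow_iff_le_right hP.one_lt).mp h2
  have hord : orderOf χ' = p ^ (j + 1) := by rw [hordχ', le_antisymm hle hge]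
  -- the quadratic character mod `p`, lifted to level `p^{j+2}`
  set chiQ0 : DirichletCharacter ℂ_[p] p := (quadraticChar (ZMod p)).ringHomComp (Int.castRingHom ℂ_[p])
    with hchiQ0_def
  have hdvd : p ∣ p ^ (j + 1 + 1) := dvd_pow_self p (by omega)
  set chiQ : DirichletCharacter ℂ_[p] (p ^ (j + 1 + 1)) := DirichletCharacter.changeLevel hdvd chiQ0
    with hchiQ_def
  have hordchiQ : orderOf chiQ = 2 := by
    rw [hchiQ_def, orderOf_injective (DirichletCharacter.changeLevel hdvd)
      (DirichletCharacter.changeLevel_injective hdvd) chiQ0, hchiQ0_def, orderOf_quadraticChar_ringHomComp hp2]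
  have hchiQγ : chiQ (cyclotomicGenerator p : ZMod (p ^ (j + 1 + 1))) = 1 := by
    have h1 := DirichletCharacter.changeLevel_eq_cast_of_dvd' chiQ0 hdvd
      (a := ((cyclotomicGenerator p : ℕ) : ℤ)) (by exact_mod_cast hcopZ)
    rw [Int.cast_natCast, Int.cast_natCast] at h1
    rw [hchiQ_def, h1, cyclotomicGenerator, he, pow_one, Nat.cast_add, Nat.cast_one, ZMod.natCast_self,
      add_zero, map_one]
  -- the product
  refine ⟨chiQ * χ', ?_, ?_⟩
  · have hcop : Nat.Coprime (orderOf chiQ) (orderOf χ') := by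
      rw [hordchiQ, hord]
      exact Nat.Coprime.pow_right _ (Nat.coprime_two_left.mpr (hP.odd_of_ne_two hp2))
    rw [(Commute.all chiQ χ').orderOf_mul_eq_mul_orderOf_of_coprime hcop, hordchiQ, hord]
  · rw [MulChar.mul_apply, hchiQγ, hχ'γ, one_mul]

/-! ## §2 Uniqueness up to a unit -/

section Unique

variable {N : ℕ} {f : CuspForm (Gamma0 N) 2}

/-- **Two solutions of Kobayashi's quadratic-branch interpolation property differ by a unit of
`ℤ_p`** (`p` odd): if `IsQuadraticBranchMinusLFunction f p ϖ L₁` and `… L₂` then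
`L₂ = v • L₁` for some `v ∈ ℤ_p^×`. [cite: Kobayashi2003, Thm. 3.2 and (3.5), (3.7) (p. 7)]
[cite: Pollack2003, Prop. 6.9 (proof) and §3] [cite: MazurTateTeitelbaum1986Invent, §I.12–I.14] -/
theorem IsQuadraticBranchMinusLFunction.exists_units_smul_eq (hp2 : p ≠ 2) {ϖ : ℚ}
    {L₁ L₂ : IwasawaAlgebra p} (h₁ : IsQuadraticBranchMinusLFunction f p ϖ L₁)
    (h₂ : IsQuadraticBranchMinusLFunction f p ϖ L₂) :
    ∃ v : ℤ_[p]ˣ, L₂ = (v : ℤ_[p]) • L₁ := by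
  have hP : p.Prime := hp.out
  obtain ⟨-, u₁, H₁⟩ := h₁
  obtain ⟨-, u₂, H₂⟩ := h₂
  -- `D = u₂ L₁ - u₁ L₂`
  set D : IwasawaAlgebra p := (u₂ : ℤ_[p]) • L₁ - (u₁ : ℤ_[p]) • L₂ with hDdef
  suffices hD0 : D = 0 by
    refine ⟨u₁⁻¹ * u₂, ?_⟩
    have h : (u₁ : ℤ_[p]) • L₂ = (u₂ : ℤ_[p]) • L₁ := (sub_eq_zero.mp hD0).symm
    calc L₂ = ((u₁⁻¹ * u₁ : ℤ_[p]ˣ) : ℤ_[p]) • L₂ := by rw [inv_mul_cancel, Units.val_one, one_smul]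
      _ = ((u₁⁻¹ : ℤ_[p]ˣ) : ℤ_[p]) • ((u₁ : ℤ_[p]) • L₂) := by rw [Units.val_mul, mul_smul]
      _ = ((u₁⁻¹ * u₂ : ℤ_[p]ˣ) : ℤ_[p]) • L₁ := by rw [h, ← mul_smul, ← Units.val_mul]
  by_contra hD
  have hD' : iwasawaToPowerSeries p D ≠ 0 := fun h0 ↦
    hD (iwasawaToPowerSeries_injective p (by rw [h0, map_zero]))
  have hfin := MemIwasawaRat.finite_setOf_hasSum_zero (memIwasawaRat_iwasawaToPowerSeries p D) hD'
  -- the levels `n_k = 2k + 1` and points `ζ_k` of order `p^{n_k}`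
  choose ζ hζ using fun k : ℕ ↦ exists_isPrimitiveRoot_padicComplex' (p := p) (2 * k + 1)
  choose ψ hψ using fun k : ℕ ↦
    exists_dirichletCharacter_orderOf_two_mul_prime_pow hp2 (Nat.succ_pos (2 * k)) (hζ k)
  set ι : ℤ_[p] →+* ℂ_[p] := (algebraMap ℚ_[p] ℂ_[p]).comp (algebraMap ℤ_[p] ℚ_[p]) with hι
  have hcoe : ∀ (L : IwasawaAlgebra p) (k : ℕ),
      algebraMap ℚ_[p] ℂ_[p] (PowerSeries.coeff k (iwasawaToPowerSeries p L)) =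
        ι (PowerSeries.coeff k L) := by
    intro L k
    simp only [hι, RingHom.comp_apply, iwasawaToPowerSeries, PowerSeries.coeff_map]
  have hcoeffD : ∀ k, PowerSeries.coeff k D =
      (u₂ : ℤ_[p]) * PowerSeries.coeff k L₁ - (u₁ : ℤ_[p]) * PowerSeries.coeff k L₂ := by
    intro k
    rw [hDdef, map_sub, PowerSeries.coeff_smul, PowerSeries.coeff_smul, smul_eq_mul, smul_eq_mul]
  -- every `ζ_k - 1` is a zero of `D` in the open unit disc
  have hmem : ∀ k, ζ k - 1 ∈ {z : ℂ_[p] | ‖z‖ < 1 ∧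
      HasSum (fun j ↦ algebraMap ℚ_[p] ℂ_[p] (PowerSeries.coeff j (iwasawaToPowerSeries p D)) *
        z ^ j) 0} := by
    intro k
    have hz : ‖ζ k - 1‖ < 1 := norm_sub_one_lt_one_of_pow_prime_pow_eq_one (hζ k).pow_eq_one
    refine ⟨hz, ?_⟩
    have e₁ := H₁ (2 * k + 1) ⟨k, rfl⟩ (ψ k) (hψ k).1
    have e₂ := H₂ (2 * k + 1) ⟨k, rfl⟩ (ψ k) (hψ k).1
    rw [(hψ k).2] at e₁ e₂
    have hsub := (e₁.mul_left (ι u₂)).sub (e₂.mul_left (ι u₁))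
    have hrhs : ι (u₂ : ℤ_[p]) * ((-1 : ℂ_[p]) ^ ((2 * k + 1 + 1) / 2) *
          algebraMap ℚ_[p] ℂ_[p] (((u₁ : ℤ_[p]) : ℚ_[p]) * (ϖ : ℚ_[p])) *
          (if Even (p / 2) then ratTwistedSymbolSum f (ψ k) else ratMinusTwistedSymbolSum f (ψ k)) /
        (cyclotomicOmegaPlus p (2 * k + 1)).eval₂ (algebraMap ℤ ℂ_[p]) (ζ k - 1)) -
        ι (u₁ : ℤ_[p]) * ((-1 : ℂ_[p]) ^ ((2 * k + 1 + 1) / 2) *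
          algebraMap ℚ_[p] ℂ_[p] (((u₂ : ℤ_[p]) : ℚ_[p]) * (ϖ : ℚ_[p])) *
          (if Even (p / 2) then ratTwistedSymbolSum f (ψ k) else ratMinusTwistedSymbolSum f (ψ k)) /
        (cyclotomicOmegaPlus p (2 * k + 1)).eval₂ (algebraMap ℤ ℂ_[p]) (ζ k - 1)) = 0 := by
      have hu : ∀ u : ℤ_[p]ˣ, algebraMap ℚ_[p] ℂ_[p] (((u : ℤ_[p]) : ℚ_[p]) * (ϖ : ℚ_[p])) =
          ι (u : ℤ_[p]) * algebraMap ℚ_[p] ℂ_[p] (ϖ : ℚ_[p]) := by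
        intro u
        rw [map_mul, hι, RingHom.comp_apply, PadicInt.algebraMap_apply]
      rw [hu u₁, hu u₂]
      ring
    rw [hrhs] at hsub
    have hfun : (fun j ↦ algebraMap ℚ_[p] ℂ_[p] (PowerSeries.coeff j (iwasawaToPowerSeries p D)) *
        (ζ k - 1) ^ j) = fun j ↦
        ι (u₂ : ℤ_[p]) * (ι (PowerSeries.coeff j L₁) * (ζ k - 1) ^ j) -
          ι (u₁ : ℤ_[p]) * (ι (PowerSeries.coeff j L₂) * (ζ k - 1) ^ j) := by
      funext j
      rw [hcoe, hcoeffD, map_sub, map_mul, map_mul]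
      ring
    rw [hfun]
    exact hsub
  -- the zeros are pairwise distinct
  have hinjζ : Function.Injective fun k ↦ ζ k - 1 := by
    intro a b hab
    have hζab : ζ a = ζ b := sub_left_injective hab
    have ho : p ^ (2 * a + 1) = p ^ (2 * b + 1) := by
      rw [(hζ a).eq_orderOf, (hζ b).eq_orderOf, hζab]
    have := Nat.pow_right_injective hP.two_le ho
    omega
  exact hfin.not_infinite
    ((Set.infinite_range_of_injective hinjζ).mono (Set.range_subset_iff.mpr hmem))

/-- **Hence the leading coefficient on the branch is determined up to a unit**:
`coeff₁ L₂ = v · coeff₁ L₁` for some `v ∈ ℤ_p^×` — so the valuation `v_p(coeff₁ L)` of the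
tree's EVIDENCE item `QuadraticBranchMinusLeadingValuationAt` (the law P2♭) does not depend on the
choice of `L`. [cite: Kobayashi2003, Thm. 3.2 and (3.5) (p. 7)] -/
theorem IsQuadraticBranchMinusLFunction.coeff_one_eq_units_mul (hp2 : p ≠ 2) {ϖ : ℚ}
    {L₁ L₂ : IwasawaAlgebra p} (h₁ : IsQuadraticBranchMinusLFunction f p ϖ L₁)
    (h₂ : IsQuadraticBranchMinusLFunction f p ϖ L₂) :
    ∃ v : ℤ_[p]ˣ, PowerSeries.coeff 1 L₂ = (v : ℤ_[p]) * PowerSeries.coeff 1 L₁ := by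
  obtain ⟨v, hv⟩ := h₁.exists_units_smul_eq hp2 h₂
  exact ⟨v, by rw [hv, PowerSeries.coeff_smul, smul_eq_mul]⟩

/-- **… so the unit certificate `IsUnit (coeff₁ L)` of the twins' route
(`OddBranchUnitCertificateAt`) is independent of the choice of `L`.**
[cite: Kobayashi2003, Thm. 3.2 and (3.5) (p. 7)] -/
theorem IsQuadraticBranchMinusLFunction.isUnit_coeff_one_iff (hp2 : p ≠ 2) {ϖ : ℚ}
    {L₁ L₂ : IwasawaAlgebra p} (h₁ : IsQuadraticBranchMinusLFunction f p ϖ L₁)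
    (h₂ : IsQuadraticBranchMinusLFunction f p ϖ L₂) :
    IsUnit (PowerSeries.coeff 1 L₁) ↔ IsUnit (PowerSeries.coeff 1 L₂) := by
  obtain ⟨v, hv⟩ := h₁.coeff_one_eq_units_mul hp2 h₂
  rw [hv, Units.isUnit_units_mul]

/-- **… and its `p`-adic absolute value (equivalently its valuation, the quantity read by P2♭) is
independent of the choice of `L`.** [cite: Kobayashi2003, Thm. 3.2 and (3.5) (p. 7)] -/
theorem IsQuadraticBranchMinusLFunction.norm_coeff_one_eq (hp2 : p ≠ 2) {ϖ : ℚ}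
    {L₁ L₂ : IwasawaAlgebra p} (h₁ : IsQuadraticBranchMinusLFunction f p ϖ L₁)
    (h₂ : IsQuadraticBranchMinusLFunction f p ϖ L₂) :
    ‖PowerSeries.coeff 1 L₁‖ = ‖PowerSeries.coeff 1 L₂‖ := by
  obtain ⟨v, hv⟩ := h₁.coeff_one_eq_units_mul hp2 h₂
  rw [hv, norm_mul, PadicInt.norm_units, one_mul]

/-- **… in particular `coeff₁ L₁ = 0 ↔ coeff₁ L₂ = 0`** (the 'order of vanishing exactly one on the
branch' reading of the E1-η census is choice-free). [cite: Kobayashi2003, (3.5), (3.7) (p. 7)] -/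
theorem IsQuadraticBranchMinusLFunction.coeff_one_eq_zero_iff (hp2 : p ≠ 2) {ϖ : ℚ}
    {L₁ L₂ : IwasawaAlgebra p} (h₁ : IsQuadraticBranchMinusLFunction f p ϖ L₁)
    (h₂ : IsQuadraticBranchMinusLFunction f p ϖ L₂) :
    PowerSeries.coeff 1 L₁ = 0 ↔ PowerSeries.coeff 1 L₂ = 0 := by
  obtain ⟨v, hv⟩ := h₁.coeff_one_eq_units_mul hp2 h₂
  rw [hv, Units.mul_right_eq_zero]

end Unique

end Summit.BirchSwinnertonDyer.Rank1Residual.Additive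

end
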